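import Summits.CriticalPhenomena.PercolationContinuityZ3.Theorems.Transplant.SkelNegBParamsRootFineYQ
import Summits.CriticalPhenomena.PercolationContinuityZ3.Theorems.Transplant.SkelNegBParamsRootFineYA
import HarnessLib

/-!
# N1 params, chain of record `NegB`, part RootFineYQ-A — the (ζ′) twin of part RootFineYQ: the y′-leg's REGION-BY-REGION readings at the (ζ′) values —
# **`KS.hQfY_lev_RA`** (region `k`'s level reading in `[−5r₁+1, 25r₁−1]`) and **`hQfY₃_RA`** (region `k`'s abscissa in `±(5r₀ − 2)`), literal (ζ′) shapes,
# given the two (ζ′) floors `hnA`/`hMA`.  (stmt-g16 2026-08-22; NEG-SCOPE §B.19 (ζ′).)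
builds on p205010 (kernel theorem, internal audit signed; external expert review pending) — nothing in this file uses p205010; NOTHING is claimed about
the node `SamePDropOfSkeletonNeg₁` (OPEN).  Pure instantiation of parts RootArithY-A/RootArithY2-A.
Lane `prim-bschramm-*`, seat `prim-bschramm-stmt` (gen 16); helper file (`--supports stmt-CriticalPhenomena-4575 --as helper`); ledger HOME/prim-bschramm-stmt/NEG-PARAMS.md.
[cite: KozmaNitzan2024, §4 p. 28 ((32) at the root), Lemma 11 (p. 22)] [cite: MartineauTassion2017, §3.2, §4.3 Lemma 4.2]
-/

noncomputable section

open scoped Classical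

namespace Summit.CriticalPhenomena.PercolationContinuityZ3.Theorems.Transplant

namespace PlanarSkeletonNeg

namespace NegB

open Literature.Probability.Percolation Literature.Probability.LatticeModels SimpleGraph
open SkelConc (Consts)
open Skelφ (shearUnit shearUnit_pos)
open Skelφ.StepI (DataN)
open TwoAxis.Para (modulus)
open Neg

namespace KS

section AtT

variable (κ : Consts) {V : Type} [DecidableEq V] [Countable V] {G : SimpleGraph V} [G.LocallyFinite] (Φ : PlanarSkeletonNeg G) (t : V)
  (p : unitInterval) (D : DataN V) (mk : ℕ) (gx fx : Neg.FSlot)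

set_option maxHeartbeats 800000 in
/-- **`hQf₁/hQf₂` of the y′-leg, region by region** (vertical `du`): region `k`'s level reading in `[−5r₁+1, 25r₁−1]` for `σ' = 1`, mirrored for `σ' = −1`.
[cite: KozmaNitzan2024, §4 p. 28] -/
theorem hQfY_lev_RA (hN : EqNumL κ Φ t p D (gT mk gx κ Φ t p D) (fT mk fx κ Φ t p D)) (hκ : (hL κ Φ t p D (gT mk gx κ Φ t p D) (fT mk fx κ Φ t p D)).natAbs ≤ 10 * nL κ Φ t p D (gT mk gx κ Φ t p D) (fT mk fx κ Φ t p D))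
    (hnA : 2000 * Neg.Kq κ * (RA' κ Φ t p D mk + 2) ≤ nL κ Φ t p D (gT mk gx κ Φ t p D) (fT mk fx κ Φ t p D)) (hMA : 22000 * Neg.Kq κ * (RA' κ Φ t p D mk + 2) ≤ ML κ Φ t p D (gT mk gx κ Φ t p D))
    {σ' : ℤ} (hσ' : σ' = 1 ∨ σ' = -1) (yY : Site 2) (hΛ₁3 : |Λ₁of κ Φ t p D (gT mk gx κ Φ t p D) (fT mk fx κ Φ t p D) yY| ≤ 3 * modulus (nL κ Φ t p D (gT mk gx κ Φ t p D) (fT mk fx κ Φ t p D)) (hL κ Φ t p D (gT mk gx κ Φ t p D) (fT mk fx κ Φ t p D)) (vL κ Φ t p D (gT mk gx κ Φ t p D) (fT mk fx κ Φ t p D)) (Skelφ.NegPrm.vβOf (nL κ Φ t p D (gT mk gx κ Φ t p D) (fT mk fx κ Φ t p D)) (hL κ Φ t p D (gT mk gx κ Φ t p D) (fT mk fx κ Φ t p D)) (ℓL κ Φ t p D (gT mk gx κ Φ t p D) (fT mk fx κ Φ t p D)) (vL κ Φ t p D (gT mk gx κ Φ t p D) (fT mk fx κ Φ t p D)))) 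:
    ∀ k ≤ NyOfA κ Φ t p D (gT mk gx κ Φ t p D) (fT mk fx κ Φ t p D) σ' yY,
      (σ' = 1 → -(5 * ((fcellsA κ Φ t p D (gT mk gx κ Φ t p D) (fT mk fx κ Φ t p D)).r 1 : ℤ)) + 1 ≤ TwoAxis.Para.coarse (20 * ((fcellsA κ Φ t p D (gT mk gx κ Φ t p D) (fT mk fx κ Φ t p D)).K : ℤ) * (((fcellsA κ Φ t p D (gT mk gx κ Φ t p D) (fT mk fx κ Φ t p D)).s 1 : ℕ) : ℤ)) (Skelφ.NegPrm.DofA (Aof κ) (nL κ Φ t p D (gT mk gx κ Φ t p D) (fT mk fx κ Φ t p D)) (hL κ Φ t p D (gT mk gx κ Φ t p D) (fT mk fx κ Φ t p D)) (ℓL κ Φ t p D (gT mk gx κ Φ t p D) (fT mk fx κ Φ t p D)) (vL κ Φ t p D (gT mk gx κ Φ t p D) (fT mk fx κ Φ t p D)) / 2) (Skelφ.NegPrm.DofA (Aof κ) (nL κ Φ t p D (gT mk gx κ Φ t p D) (fT mk fx κ Φ t p D)) (hL κ Φ t p D (gT mk gx κ Φ t p D) (fT mk fx κ Φ t p D)) (ℓL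 κ Φ t p D (gT mk gx κ Φ t p D) (fT mk fx κ Φ t p D)) (vL κ Φ t p D (gT mk gx κ Φ t p D) (fT mk fx κ Φ t p D))) (TwoAxis.Para.lam1 (Aof κ) (nL κ Φ t p D (gT mk gx κ Φ t p D) (fT mk fx κ Φ t p D) : ℤ) (hL κ Φ t p D (gT mk gx κ Φ t p D) (fT mk fx κ Φ t p D)) yY) + ((20 * ((fcellsA κ Φ t p D (gT mk gx κ Φ t p D) (fT mk fx κ Φ t p D)).K : ℤ) * (((fcellsA κ Φ t p D (gT mk gx κ Φ t p D) (fT mk fx κ Φ t p D)).s 1 : ℕ) : ℤ)) * (Aof κ * ((shearUnit (nL κ Φ t p D (gT mk gx κ Φ t p D) (fT mk fx κ Φ t p D)) (hL κ Φ t p D (gT mk gx κ Φ t p D) (fT mk fx κ Φ t p D)) : ℤ) * (min (σ' * (qbLo κ Φ t p D (gT mk gx κ Φ t p D) (fT mk fx κ Φ t p D) mk (qY κ Φ t p D (gT mk gx κ Φ t p D) (fT mk fx κ Φ t p D) mk) k)) (σ' * (qbHi κ Φ t p D (gT mk gx κ Φ t p D) (fT mk fx κ Φ t p D) mk (qY κ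 Φ t p D (gT mk gx κ Φ t p D) (fT mk fx κ Φ t p D) mk) k)) - 1)))) / (Skelφ.NegPrm.DofA (Aof κ) (nL κ Φ t p D (gT mk gx κ Φ t p D) (fT mk fx κ Φ t p D)) (hL κ Φ t p D (gT mk gx κ Φ t p D) (fT mk fx κ Φ t p D)) (ℓL κ Φ t p D (gT mk gx κ Φ t p D) (fT mk fx κ Φ t p D)) (vL κ Φ t p D (gT mk gx κ Φ t p D) (fT mk fx κ Φ t p D))) ∧
        TwoAxis.Para.coarse (20 * ((fcellsA κ Φ t p D (gT mk gx κ Φ t p D) (fT mk fx κ Φ t p D)).K : ℤ) * (((fcellsA κ Φ t p D (gT mk gx κ Φ t p D) (fT mk fx κ Φ t p D)).s 1 : ℕ) : ℤ)) (Skelφ.NegPrm.DofA (Aof κ) (nL κ Φ t p D (gT mk gx κ Φ t p D) (fT mk fx κ Φ t p D)) (hL κ Φ t p D (gT mk gx κ Φ t p D) (fT mk fx κ Φ t p D)) (ℓL κ Φ t p D (gT mk gx κ Φ t p D) (fT mk fx κ Φ t p D)) (vL κ Φ t p D (gT mk gx κ Φ t p D) (fT mk fx κ Φ t p D)) / 2)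 (Skelφ.NegPrm.DofA (Aof κ) (nL κ Φ t p D (gT mk gx κ Φ t p D) (fT mk fx κ Φ t p D)) (hL κ Φ t p D (gT mk gx κ Φ t p D) (fT mk fx κ Φ t p D)) (ℓL κ Φ t p D (gT mk gx κ Φ t p D) (fT mk fx κ Φ t p D)) (vL κ Φ t p D (gT mk gx κ Φ t p D) (fT mk fx κ Φ t p D))) (TwoAxis.Para.lam1 (Aof κ) (nL κ Φ t p D (gT mk gx κ Φ t p D) (fT mk fx κ Φ t p D) : ℤ) (hL κ Φ t p D (gT mk gx κ Φ t p D) (fT mk fx κ Φ t p D)) yY) +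
        ((20 * ((fcellsA κ Φ t p D (gT mk gx κ Φ t p D) (fT mk fx κ Φ t p D)).K : ℤ) * (((fcellsA κ Φ t p D (gT mk gx κ Φ t p D) (fT mk fx κ Φ t p D)).s 1 : ℕ) : ℤ)) * (Aof κ * ((shearUnit (nL κ Φ t p D (gT mk gx κ Φ t p D) (fT mk fx κ Φ t p D)) (hL κ Φ t p D (gT mk gx κ Φ t p D) (fT mk fx κ Φ t p D)) : ℤ) * (max (σ' * (qbLo κ Φ t p D (gT mk gx κ Φ t p D) (fT mk fx κ Φ t p D) mk (qY κ Φ t p D (gT mk gx κ Φ t p D) (fT mk fx κ Φ t p D) mk) k)) (σ' * (qbHi κ Φ t p D (gT mk gx κ Φ t p D) (fT mk fx κ Φ t p D) mk (qY κ Φ t p D (gT mk gx κ Φ t p D) (fT mk fx κ Φ t p D) mk) k))) + (shearUnit (nL κ Φ t p D (gT mk gx κ Φ t p D) (fT mk fx κ Φ t p D)) (hL κ Φ t p D (gT mk gx κ Φ t p D) (fT mk fx κ Φ t p D)) : ℤ) - 1))) / (Skelφ.NegPrm.DofA (Aof κ) (nL κ Φ t p D (gT mk gx κ Φ t p D) (fT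 mk fx κ Φ t p D)) (hL κ Φ t p D (gT mk gx κ Φ t p D) (fT mk fx κ Φ t p D)) (ℓL κ Φ t p D (gT mk gx κ Φ t p D) (fT mk fx κ Φ t p D)) (vL κ Φ t p D (gT mk gx κ Φ t p D) (fT mk fx κ Φ t p D))) + 1 ≤ 25 * ((fcellsA κ Φ t p D (gT mk gx κ Φ t p D) (fT mk fx κ Φ t p D)).r 1 : ℤ) - 1) ∧
      (σ' = -1 → -(5 * ((fcellsA κ Φ t p D (gT mk gx κ Φ t p D) (fT mk fx κ Φ t p D)).r 1 : ℤ)) + 1 ≤ -(TwoAxis.Para.coarse (20 * ((fcellsA κ Φ t p D (gT mk gx κ Φ t p D) (fT mk fx κ Φ t p D)).K : ℤ) * (((fcellsA κ Φ t p D (gT mk gx κ Φ t p D) (fT mk fx κ Φ t p D)).s 1 : ℕ) : ℤ)) (Skelφ.NegPrm.DofA (Aof κ) (nL κ Φ t p D (gT mk gx κ Φ t p D) (fT mk fx κ Φ t p D)) (hL κ Φ t p D (gT mk gx κ Φ t p D) (fT mk fx κ Φ t p D)) (ℓL κ Φ t p D (gT mk gx κ Φ t p D) (fT mk fx κ Φ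 t p D)) (vL κ Φ t p D (gT mk gx κ Φ t p D) (fT mk fx κ Φ t p D)) / 2) (Skelφ.NegPrm.DofA (Aof κ) (nL κ Φ t p D (gT mk gx κ Φ t p D) (fT mk fx κ Φ t p D)) (hL κ Φ t p D (gT mk gx κ Φ t p D) (fT mk fx κ Φ t p D)) (ℓL κ Φ t p D (gT mk gx κ Φ t p D) (fT mk fx κ Φ t p D)) (vL κ Φ t p D (gT mk gx κ Φ t p D) (fT mk fx κ Φ t p D))) (TwoAxis.Para.lam1 (Aof κ) (nL κ Φ t p D (gT mk gx κ Φ t p D) (fT mk fx κ Φ t p D) : ℤ) (hL κ Φ t p D (gT mk gx κ Φ t p D) (fT mk fx κ Φ t p D)) yY) +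
        ((20 * ((fcellsA κ Φ t p D (gT mk gx κ Φ t p D) (fT mk fx κ Φ t p D)).K : ℤ) * (((fcellsA κ Φ t p D (gT mk gx κ Φ t p D) (fT mk fx κ Φ t p D)).s 1 : ℕ) : ℤ)) * (Aof κ * ((shearUnit (nL κ Φ t p D (gT mk gx κ Φ t p D) (fT mk fx κ Φ t p D)) (hL κ Φ t p D (gT mk gx κ Φ t p D) (fT mk fx κ Φ t p D)) : ℤ) * (max (σ' * (qbLo κ Φ t p D (gT mk gx κ Φ t p D) (fT mk fx κ Φ t p D) mk (qY κ Φ t p D (gT mk gx κ Φ t p D) (fT mk fx κ Φ t p D) mk) k)) (σ' * (qbHi κ Φ t p D (gT mk gx κ Φ t p D) (fT mk fx κ Φ t p D) mk (qY κ Φ t p D (gT mk gx κ Φ t p D) (fT mk fx κ Φ t p D) mk) k))) + (shearUnit (nL κ Φ t p D (gT mk gx κ Φ t p D) (fT mk fx κ Φ t p D)) (hL κ Φ t p D (gT mk gx κ Φ t p D) (fT mk fx κ Φ t p D)) : ℤ) - 1))) / (Skelφ.NegPrm.DofA (Aof κ) (nL κ Φ t p D (gT mk gx κ Φ t p D) (fT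 mk fx κ Φ t p D)) (hL κ Φ t p D (gT mk gx κ Φ t p D) (fT mk fx κ Φ t p D)) (ℓL κ Φ t p D (gT mk gx κ Φ t p D) (fT mk fx κ Φ t p D)) (vL κ Φ t p D (gT mk gx κ Φ t p D) (fT mk fx κ Φ t p D))) + 1) ∧
        -(TwoAxis.Para.coarse (20 * ((fcellsA κ Φ t p D (gT mk gx κ Φ t p D) (fT mk fx κ Φ t p D)).K : ℤ) * (((fcellsA κ Φ t p D (gT mk gx κ Φ t p D) (fT mk fx κ Φ t p D)).s 1 : ℕ) : ℤ)) (Skelφ.NegPrm.DofA (Aof κ) (nL κ Φ t p D (gT mk gx κ Φ t p D) (fT mk fx κ Φ t p D)) (hL κ Φ t p D (gT mk gx κ Φ t p D) (fT mk fx κ Φ t p D)) (ℓL κ Φ t p D (gT mk gx κ Φ t p D) (fT mk fx κ Φ t p D)) (vL κ Φ t p D (gT mk gx κ Φ t p D) (fT mk fx κ Φ t p D)) / 2) (Skelφ.NegPrm.DofA (Aof κ) (nL κ Φ t p D (gT mk gx κ Φ t p D) (fT mk fx κ Φ t p D)) (hL κ Φ t p D (gT mk gx κ Φ t p D) (fT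 mk fx κ Φ t p D)) (ℓL κ Φ t p D (gT mk gx κ Φ t p D) (fT mk fx κ Φ t p D)) (vL κ Φ t p D (gT mk gx κ Φ t p D) (fT mk fx κ Φ t p D))) (TwoAxis.Para.lam1 (Aof κ) (nL κ Φ t p D (gT mk gx κ Φ t p D) (fT mk fx κ Φ t p D) : ℤ) (hL κ Φ t p D (gT mk gx κ Φ t p D) (fT mk fx κ Φ t p D)) yY) + ((20 * ((fcellsA κ Φ t p D (gT mk gx κ Φ t p D) (fT mk fx κ Φ t p D)).K : ℤ) * (((fcellsA κ Φ t p D (gT mk gx κ Φ t p D) (fT mk fx κ Φ t p D)).s 1 : ℕ) : ℤ)) * (Aof κ * ((shearUnit (nL κ Φ t p D (gT mk gx κ Φ t p D) (fT mk fx κ Φ t p D)) (hL κ Φ t p D (gT mk gx κ Φ t p D) (fT mk fx κ Φ t p D)) : ℤ) * (min (σ' * (qbLo κ Φ t p D (gT mk gx κ Φ t p D) (fT mk fx κ Φ t p D) mk (qY κ Φ t p D (gT mk gx κ Φ t p D) (fT mk fx κ Φ t p D) mk) k)) (σ' * (qbHi κ Φ t p D (gT mk gx κ Φ t p D) (fT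 mk fx κ Φ t p D) mk (qY κ Φ t p D (gT mk gx κ Φ t p D) (fT mk fx κ Φ t p D) mk) k)) - 1)))) / (Skelφ.NegPrm.DofA (Aof κ) (nL κ Φ t p D (gT mk gx κ Φ t p D) (fT mk fx κ Φ t p D)) (hL κ Φ t p D (gT mk gx κ Φ t p D) (fT mk fx κ Φ t p D)) (ℓL κ Φ t p D (gT mk gx κ Φ t p D) (fT mk fx κ Φ t p D)) (vL κ Φ t p D (gT mk gx κ Φ t p D) (fT mk fx κ Φ t p D)))) ≤ 25 * ((fcellsA κ Φ t p D (gT mk gx κ Φ t p D) (fT mk fx κ Φ t p D)).r 1 : ℤ) - 1) := by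
  obtain ⟨hn1, hℓ1⟩ := one_le_of_eqNumL κ Φ t p D _ _ hN
  have hm0 := (Skelφ.NegPrm.modulus_vβOf hn1 (hL κ Φ t p D (gT mk gx κ Φ t p D) (fT mk fx κ Φ t p D)) (ℓL κ Φ t p D (gT mk gx κ Φ t p D) (fT mk fx κ Φ t p D)) (vL κ Φ t p D (gT mk gx κ Φ t p D) (fT mk fx κ Φ t p D))).1
  have hmℓ := (Skelφ.NegPrm.modulus_vβOf hn1 (hL κ Φ t p D (gT mk gx κ Φ t p D) (fT mk fx κ Φ t p D)) (ℓL κ Φ t p D (gT mk gx κ Φ t p D) (fT mk fx κ Φ t p D)) (vL κ Φ t p D (gT mk gx κ Φ t p D) (fT mk fx κ Φ t p D))).2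
  have hm : (nL κ Φ t p D (gT mk gx κ Φ t p D) (fT mk fx κ Φ t p D) : ℤ) * ((ℓL κ Φ t p D (gT mk gx κ Φ t p D) (fT mk fx κ Φ t p D) : ℤ) - 1) < modulus (nL κ Φ t p D (gT mk gx κ Φ t p D) (fT mk fx κ Φ t p D)) (hL κ Φ t p D (gT mk gx κ Φ t p D) (fT mk fx κ Φ t p D)) (vL κ Φ t p D (gT mk gx κ Φ t p D) (fT mk fx κ Φ t p D)) (Skelφ.NegPrm.vβOf (nL κ Φ t p D (gT mk gx κ Φ t p D) (fT mk fx κ Φ t p D)) (hL κ Φ t p D (gT mk gx κ Φ t p D) (fT mk fx κ Φ t p D)) (ℓL κ Φ t p D (gT mk gx κ Φ t p D) (fT mk fx κ Φ t p D)) (vL κ Φ t p D (gT mk gx κ Φ t p D) (fT mk fx κ Φ t p D))) := by linarith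
  obtain ⟨hc0, hc1, hr0, hr1, hb0, hb1, hu0', hu1⟩ := units_eqA κ Φ t p D (gT mk gx κ Φ t p D) (fT mk fx κ Φ t p D)
  have hA2 : (2 : ℤ) ≤ Aof κ := by have := le_Aof κ; linarith
  have hAe : (2 : ℤ) ∣ Aof κ := ⟨10 * (Neg.K κ : ℤ), by rw [Aof_eq_K]; ring⟩
  have hKq : (1 : ℤ) ≤ (Neg.Kq κ : ℤ) := by exact_mod_cast Neg.one_le_Kq κ
  have hKq0 : (0 : ℤ) ≤ 1000 * (Neg.Kq κ : ℤ) := by linarith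
  have hKq1 : (0 : ℤ) ≤ 1000 * (Neg.Kq κ : ℤ) - 1 := by linarith
  have hv : |(vL κ Φ t p D (gT mk gx κ Φ t p D) (fT mk fx κ Φ t p D))| ≤ (nL κ Φ t p D (gT mk gx κ Φ t p D) (fT mk fx κ Φ t p D) : ℤ) := hN.v_le
  have hn : (1 : ℤ) ≤ (nL κ Φ t p D (gT mk gx κ Φ t p D) (fT mk fx κ Φ t p D) : ℤ) := by exact_mod_cast hn1
  have h10 : ((((hL κ Φ t p D (gT mk gx κ Φ t p D) (fT mk fx κ Φ t p D))).natAbs : ℤ)) ≤ 10 * (nL κ Φ t p D (gT mk gx κ Φ t p D) (fT mk fx κ Φ t p D) : ℤ) := by exact_mod_cast hκ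
  have h0' : (0 : ℤ) ≤ ((((hL κ Φ t p D (gT mk gx κ Φ t p D) (fT mk fx κ Φ t p D))).natAbs : ℤ)) := Nat.cast_nonneg _
  have hU : (nL κ Φ t p D (gT mk gx κ Φ t p D) (fT mk fx κ Φ t p D) : ℤ) ≤ (shearUnit (nL κ Φ t p D (gT mk gx κ Φ t p D) (fT mk fx κ Φ t p D)) (hL κ Φ t p D (gT mk gx κ Φ t p D) (fT mk fx κ Φ t p D)) : ℤ) ∧ (shearUnit (nL κ Φ t p D (gT mk gx κ Φ t p D) (fT mk fx κ Φ t p D)) (hL κ Φ t p D (gT mk gx κ Φ t p D) (fT mk fx κ Φ t p D)) : ℤ) ≤ 11 * (nL κ Φ t p D (gT mk gx κ Φ t p D) (fT mk fx κ Φ t p D) : ℤ) := by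
    unfold Skelφ.shearUnit; simp only [Nat.cast_add]; constructor <;> linarith
  have hRA : (0 : ℤ) ≤ (RA' κ Φ t p D mk : ℤ) := Nat.cast_nonneg _
  have hRAn : 2000 * (Neg.Kq κ : ℤ) * ((RA' κ Φ t p D mk : ℤ) + 2) ≤ (nL κ Φ t p D (gT mk gx κ Φ t p D) (fT mk fx κ Φ t p D) : ℤ) := by exact_mod_cast hnA
  have hRAℓ : 22000 * (Neg.Kq κ : ℤ) * ((RA' κ Φ t p D mk : ℤ) + 2) ≤ (ℓL κ Φ t p D (gT mk gx κ Φ t p D) (fT mk fx κ Φ t p D) : ℤ) := by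
    have h1 : ((22000 * Neg.Kq κ * (RA' κ Φ t p D mk + 2) : ℕ) : ℤ) ≤ (ML κ Φ t p D (gT mk gx κ Φ t p D) : ℤ) := by exact_mod_cast hMA
    have h2 := hN.ℓ_le
    push_cast at h1; linarith
  clear hnA hMA
  have hℓ44 : (44000 : ℤ) ≤ (ℓL κ Φ t p D (gT mk gx κ Φ t p D) (fT mk fx κ Φ t p D) : ℤ) := by
    have hQRA : (0 : ℤ) ≤ (Neg.Kq κ : ℤ) * (RA' κ Φ t p D mk : ℤ) := mul_nonneg (Nat.cast_nonneg _) (Nat.cast_nonneg _)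
    linarith
  obtain ⟨sL, sH, sH', sLa⟩ := sY_spec κ Φ t p D (gT mk gx κ Φ t p D) (fT mk fx κ Φ t p D) hn1
  have hUpos : (0:ℤ) < (shearUnit (nL κ Φ t p D (gT mk gx κ Φ t p D) (fT mk fx κ Φ t p D)) (hL κ Φ t p D (gT mk gx κ Φ t p D) (fT mk fx κ Φ t p D)) : ℤ) := by linarith
  have sL' : (shearUnit (nL κ Φ t p D (gT mk gx κ Φ t p D) (fT mk fx κ Φ t p D)) (hL κ Φ t p D (gT mk gx κ Φ t p D) (fT mk fx κ Φ t p D)) : ℤ) * sLoY κ Φ t p D (gT mk gx κ Φ t p D) (fT mk fx κ Φ t p D) ≤ (nL κ Φ t p D (gT mk gx κ Φ t p D) (fT mk fx κ Φ t p D) : ℤ) * (ℓL κ Φ t p D (gT mk gx κ Φ t p D) (fT mk fx κ Φ t p D) : ℤ) - (shearUnit (nL κ Φ t p D (gT mk gx κ Φ t p D) (fT mk fx κ Φ t p D)) (hL κ Φ t p D (gT mk gx κ Φ t p D) (fT mk fx κ Φ t p D)) : ℤ) + 1 := by unfold sLoY; exact Int.mul_ediv_self_le hUpos.ne'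
  have hUqY : (shearUnit (nL κ Φ t p D (gT mk gx κ Φ t p D) (fT mk fx κ Φ t p D)) (hL κ Φ t p D (gT mk gx κ Φ t p D) (fT mk fx κ Φ t p D)) : ℤ) * ((qY κ Φ t p D (gT mk gx κ Φ t p D) (fT mk fx κ Φ t p D) mk) : ℤ) ≤ (nL κ Φ t p D (gT mk gx κ Φ t p D) (fT mk fx κ Φ t p D) : ℤ) * (ℓL κ Φ t p D (gT mk gx κ Φ t p D) (fT mk fx κ Φ t p D) : ℤ) + (shearUnit (nL κ Φ t p D (gT mk gx κ Φ t p D) (fT mk fx κ Φ t p D)) (hL κ Φ t p D (gT mk gx κ Φ t p D) (fT mk fx κ Φ t p D)) : ℤ) * (4 * (RA' κ Φ t p D mk : ℤ) + 4) := by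
    unfold qY; push_cast
    have hW := (Wrun_spec κ Φ t p D (gT mk gx κ Φ t p D) (fT mk fx κ Φ t p D) hn1).1
    nlinarith [hU.1]
  obtain ⟨hN', hcen⟩ := NyOfA_spec κ Φ t p D (gT mk gx κ Φ t p D) (fT mk fx κ Φ t p D) hN hσ' yY hΛ₁3
  have hN1 : ((NyOfA κ Φ t p D (gT mk gx κ Φ t p D) (fT mk fx κ Φ t p D) σ' yY) : ℤ) + 1 ≤ 1000 * (Neg.Kq κ : ℤ) := by
    have h' : ((0 + 1 + 3 + 1 + NyOfA κ Φ t p D (gT mk gx κ Φ t p D) (fT mk fx κ Φ t p D) σ' yY : ℕ) : ℤ) ≤ ((1000 * Neg.Kq κ : ℕ) : ℤ) := by exact_mod_cast hN'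
    push_cast at h'; linarith
  clear hN'
  have hq0 : (0:ℤ) ≤ ((qY κ Φ t p D (gT mk gx κ Φ t p D) (fT mk fx κ Φ t p D) mk) : ℤ) := Nat.cast_nonneg _
  have hLa0 : (0:ℤ) ≤ (LaY κ Φ t p D (gT mk gx κ Φ t p D) (fT mk fx κ Φ t p D) : ℤ) := Nat.cast_nonneg _
  intro k hk
  have hk0 : (0:ℤ) ≤ (k:ℤ) := Nat.cast_nonneg _
  have hkN : (k:ℤ) ≤ ((NyOfA κ Φ t p D (gT mk gx κ Φ t p D) (fT mk fx κ Φ t p D) σ' yY) : ℤ) := by exact_mod_cast hk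
  clear hk
  rw [F1cA_eq_lit] at hcen
  unfold TwoAxis.Para.coarse
  rw [hc1, DofA_eq', (lam_eqA κ Φ t p D (gT mk gx κ Φ t p D) (fT mk fx κ Φ t p D) yY).2]
  have e1 : -(5 * ((fcellsA κ Φ t p D (gT mk gx κ Φ t p D) (fT mk fx κ Φ t p D)).r 1 : ℤ)) + 1 = -(5 * (40 * (Neg.Kq κ : ℤ) * u₁A κ Φ t p D (gT mk gx κ Φ t p D) (fT mk fx κ Φ t p D))) + 1 := by rw [hr1]
  have e2 : 25 * ((fcellsA κ Φ t p D (gT mk gx κ Φ t p D) (fT mk fx κ Φ t p D)).r 1 : ℤ) - 1 = 25 * (40 * (Neg.Kq κ : ℤ) * u₁A κ Φ t p D (gT mk gx κ Φ t p D) (fT mk fx κ Φ t p D)) - 1 := by rw [hr1]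
  rw [e1, e2]
  unfold qbLo qbHi
  generalize Λ₁of κ Φ t p D (gT mk gx κ Φ t p D) (fT mk fx κ Φ t p D) yY = Λ at hΛ₁3 hcen ⊢
  generalize u₁A κ Φ t p D (gT mk gx κ Φ t p D) (fT mk fx κ Φ t p D) = u at hu1 hcen ⊢
  generalize ((NyOfA κ Φ t p D (gT mk gx κ Φ t p D) (fT mk fx κ Φ t p D) σ' yY) : ℤ) = N at hN1 hkN hcen ⊢
  generalize (k : ℤ) = K at hk0 hkN ⊢
  generalize modulus (nL κ Φ t p D (gT mk gx κ Φ t p D) (fT mk fx κ Φ t p D)) (hL κ Φ t p D (gT mk gx κ Φ t p D) (fT mk fx κ Φ t p D)) (vL κ Φ t p D (gT mk gx κ Φ t p D) (fT mk fx κ Φ t p D)) (Skelφ.NegPrm.vβOf (nL κ Φ t p D (gT mk gx κ Φ t p D) (fT mk fx κ Φ t p D)) (hL κ Φ t p D (gT mk gx κ Φ t p D) (fT mk fx κ Φ t p D)) (ℓL κ Φ t p D (gT mk gx κ Φ t p D) (fT mk fx κ Φ t p D)) (vL κ Φ t p D (gT mk gx κ Φ t p D) (fT mk fx κ Φ t p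 D))) = M at hm hmℓ hΛ₁3 hcen ⊢
  generalize ((qY κ Φ t p D (gT mk gx κ Φ t p D) (fT mk fx κ Φ t p D) mk) : ℤ) = Q at hUqY hq0 ⊢
  generalize sLoY κ Φ t p D (gT mk gx κ Φ t p D) (fT mk fx κ Φ t p D) = sl at sL sL' ⊢
  generalize sHiY κ Φ t p D (gT mk gx κ Φ t p D) (fT mk fx κ Φ t p D) = sh at sH sH' ⊢
  generalize (LaY κ Φ t p D (gT mk gx κ Φ t p D) (fT mk fx κ Φ t p D) : ℤ) = La at sLa hLa0 ⊢
  generalize (shearUnit (nL κ Φ t p D (gT mk gx κ Φ t p D) (fT mk fx κ Φ t p D)) (hL κ Φ t p D (gT mk gx κ Φ t p D) (fT mk fx κ Φ t p D)) : ℤ) = Uz at hU hUpos sL sL' sH sH' sLa hUqY ⊢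
  generalize (vL κ Φ t p D (gT mk gx κ Φ t p D) (fT mk fx κ Φ t p D)) = v at hv ⊢
  generalize (RA' κ Φ t p D mk : ℤ) = R at hRA hRAn hRAℓ hUqY ⊢
  generalize (nL κ Φ t p D (gT mk gx κ Φ t p D) (fT mk fx κ Φ t p D) : ℤ) = n at hn hm hmℓ hU hRAn sL sL' sH sH' sLa hUqY hv ⊢
  generalize (ℓL κ Φ t p D (gT mk gx κ Φ t p D) (fT mk fx κ Φ t p D) : ℤ) = ℓ at hm hmℓ hRAℓ hℓ44 sL sL' sH sH' sLa hUqY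
  clear e1 e2 hc0 hc1 hr0 hr1 hb0 hb1 hu0' hm0 h10 h0' hκ hN
  generalize (Neg.Kq κ : ℤ) = Qq at hKq hKq0 hKq1 hN1 hRAn hRAℓ hcen ⊢
  -- the level window of region `K`
  have hK1 : K + 1 ≤ 1000 * Qq := by linarith
  have e1 := mul_le_mul_of_nonneg_left sL hk0
  have e2 := mul_le_mul_of_nonneg_left hmℓ hk0
  have e3 := mul_le_mul_of_nonneg_left sH hk0
  have e4 := mul_le_mul_of_nonneg_left (show n * ℓ ≤ M + n by linarith) hk0
  have hKn : (0:ℤ) ≤ K * n := mul_nonneg hk0 (by linarith)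
  have hKU : (0:ℤ) ≤ K * Uz := mul_nonneg hk0 hUpos.le
  have hKR : (0:ℤ) ≤ (K + 1) * (Uz * R) := mul_nonneg (by linarith) (mul_nonneg hUpos.le hRA)
  have hbL : K * M - (K * (n + 2 * Uz) + Uz * Q + (K + 1) * (Uz * R) + 3 * (n * ℓ) + 3 * Uz) ≤ Uz * (K * sl - Q - K * R - R - La) - Uz := by
    have : Uz * (K * sl - Q - K * R - R - La) = K * (Uz * sl) - Uz * Q - (K + 1) * (Uz * R) - Uz * La := by ring
    rw [this]; linarith
  have hbH : Uz * (K * sh + Q + K * R + R + La) + Uz - 1 ≤ K * M + (K * (n + 2 * Uz) + Uz * Q + (K + 1) * (Uz * R) + 3 * (n * ℓ) + 3 * Uz) := by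
    have : Uz * (K * sh + Q + K * R + R + La) = K * (Uz * sh) + Uz * Q + (K + 1) * (Uz * R) + Uz * La := by ring
    rw [this]; linarith
  have hss : sl < sh := by
    by_contra hc; push Not at hc
    have := mul_le_mul_of_nonneg_left hc hUpos.le
    linarith
  have hbLH : K * sl - Q - K * R - R - La ≤ K * sh + Q + K * R + R + La := by
    have := mul_le_mul_of_nonneg_left hss.le hk0
    have : (0:ℤ) ≤ K * R := mul_nonneg hk0 hRA
    linarith
  obtain ⟨l1, l2⟩ := RootArith.levels_abs (m := M) (K := K) (rβ := K * (n + 2 * Uz) + Uz * Q + (K + 1) * (Uz * R) + 3 * (n * ℓ) + 3 * Uz) (by linarith) hσ' hbL hbLH hbH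
  have hX1 : |Uz * (min (σ' * (K * sl - Q - K * R - R - La)) (σ' * (K * sh + Q + K * R + R + La)) - 1) - σ' * (K * M)| ≤
      K * (n + 2 * Uz) + Uz * Q + (K + 1) * (Uz * R) + 3 * (n * ℓ) + 3 * Uz + Uz := by
    have : Uz * (min (σ' * (K * sl - Q - K * R - R - La)) (σ' * (K * sh + Q + K * R + R + La)) - 1) =
        Uz * (min (σ' * (K * sl - Q - K * R - R - La)) (σ' * (K * sh + Q + K * R + R + La))) - Uz := by ring
    rw [this]; exact l1
  have hr7 : K * (n + 2 * Uz) + Uz * Q + (K + 1) * (Uz * R) + 3 * (n * ℓ) + 3 * Uz + Uz + 1 ≤ 7 * M := by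
    have t1 : K * (n + 2 * Uz) ≤ (1000 * Qq - 1) * (23 * n) := mul_le_mul (by linarith) (by linarith [hU.2]) (by linarith [hU.1]) hKq1
    have t2 : (K + 1) * (Uz * R) ≤ 1000 * Qq * (11 * n * R) := mul_le_mul hK1 (mul_le_mul_of_nonneg_right hU.2 hRA) (mul_nonneg hUpos.le hRA) hKq0
    have t3 : Uz * (4 * R + 4) ≤ 11 * n * (4 * R + 4) := mul_le_mul_of_nonneg_right hU.2 (by linarith)
    have t4 : n * (22000 * Qq * (R + 2)) ≤ n * ℓ := mul_le_mul_of_nonneg_left hRAℓ (le_trans zero_le_one hn)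
    have t5 : (0:ℤ) ≤ n * R := mul_nonneg (by linarith) hRA
    have t6 := le_mul_of_one_le_left t5 hKq
    have t7 := le_mul_of_one_le_left (le_trans zero_le_one hn) hKq
    linarith [hU.2]
  have hX2 := l2
  exact RootArithA.regionY_alongA (A := Aof κ) (Q := Qq) (u := u) (Λ := Λ) (Aof_pos κ).1 hAe hKq hu1 hn hm hℓ44 hσ' hk0 hkN hX1 hX2 hr7 hΛ₁3 hcen

set_option maxHeartbeats 800000 in
/-- **`hQf₃` of the y′-leg, region by region** (either `σ'`): region `k`'s fine abscissa within `±(5r₀ − 2)` (`u₀ ≥ 17`, sharp origin size, origin relation).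
[cite: KozmaNitzan2024, §4 p. 28] -/
theorem hQfY₃_RA (hN : EqNumL κ Φ t p D (gT mk gx κ Φ t p D) (fT mk fx κ Φ t p D)) (hκ : (hL κ Φ t p D (gT mk gx κ Φ t p D) (fT mk fx κ Φ t p D)).natAbs ≤ 10 * nL κ Φ t p D (gT mk gx κ Φ t p D) (fT mk fx κ Φ t p D))
    (hnA : 2000 * Neg.Kq κ * (RA' κ Φ t p D mk + 2) ≤ nL κ Φ t p D (gT mk gx κ Φ t p D) (fT mk fx κ Φ t p D)) (hMA : 22000 * Neg.Kq κ * (RA' κ Φ t p D mk + 2) ≤ ML κ Φ t p D (gT mk gx κ Φ t p D))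
    {σu σ' : ℤ} (hσu : σu = 1 ∨ σu = -1) (hσ' : σ' = 1 ∨ σ' = -1) (yX yY : Site 2) (hΛ₁3 : |Λ₁of κ Φ t p D (gT mk gx κ Φ t p D) (fT mk fx κ Φ t p D) yY| ≤ 3 * modulus (nL κ Φ t p D (gT mk gx κ Φ t p D) (fT mk fx κ Φ t p D)) (hL κ Φ t p D (gT mk gx κ Φ t p D) (fT mk fx κ Φ t p D)) (vL κ Φ t p D (gT mk gx κ Φ t p D) (fT mk fx κ Φ t p D)) (Skelφ.NegPrm.vβOf (nL κ Φ t p D (gT mk gx κ Φ t p D) (fT mk fx κ Φ t p D)) (hL κ Φ t p D (gT mk gx κ Φ t p D) (fT mk fx κ Φ t p D)) (ℓL κ Φ t p D (gT mk gx κ Φ t p D) (fT mk fx κ Φ t p D)) (vL κ Φ t p D (gT mk gx κ Φ t p D) (fT mk fx κ Φ t p D))))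
    {ρ : ℤ} (hρ0 : 0 ≤ ρ) (hρ1' : ρ < (nL κ Φ t p D (gT mk gx κ Φ t p D) (fT mk fx κ Φ t p D) : ℤ))
    (hrel : (nL κ Φ t p D (gT mk gx κ Φ t p D) (fT mk fx κ Φ t p D) : ℤ) * Λ₀of κ Φ t p D (gT mk gx κ Φ t p D) (fT mk fx κ Φ t p D) yY = (nL κ Φ t p D (gT mk gx κ Φ t p D) (fT mk fx κ Φ t p D) : ℤ) * Λ₀of κ Φ t p D (gT mk gx κ Φ t p D) (fT mk fx κ Φ t p D) yX + 4 * σu * (nL κ Φ t p D (gT mk gx κ Φ t p D) (fT mk fx κ Φ t p D) : ℤ) * modulus (nL κ Φ t p D (gT mk gx κ Φ t p D) (fT mk fx κ Φ t p D)) (hL κ Φ t p D (gT mk gx κ Φ t p D) (fT mk fx κ Φ t p D)) (vL κ Φ t p D (gT mk gx κ Φ t p D) (fT mk fx κ Φ t p D)) (Skelφ.NegPrm.vβOf (nL κ Φ t p D (gT mk gx κ Φ t p D) (fT mk fx κ Φ t p D)) (hL κ Φ t p D (gT mk gx κ Φ t p D) (fT mk fx κ Φ t p D)) (ℓL κ Φ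 t p D (gT mk gx κ Φ t p D) (fT mk fx κ Φ t p D)) (vL κ Φ t p D (gT mk gx κ Φ t p D) (fT mk fx κ Φ t p D))) + σ' * vL κ Φ t p D (gT mk gx κ Φ t p D) (fT mk fx κ Φ t p D) * modulus (nL κ Φ t p D (gT mk gx κ Φ t p D) (fT mk fx κ Φ t p D)) (hL κ Φ t p D (gT mk gx κ Φ t p D) (fT mk fx κ Φ t p D)) (vL κ Φ t p D (gT mk gx κ Φ t p D) (fT mk fx κ Φ t p D)) (Skelφ.NegPrm.vβOf (nL κ Φ t p D (gT mk gx κ Φ t p D) (fT mk fx κ Φ t p D)) (hL κ Φ t p D (gT mk gx κ Φ t p D) (fT mk fx κ Φ t p D)) (ℓL κ Φ t p D (gT mk gx κ Φ t p D) (fT mk fx κ Φ t p D)) (vL κ Φ t p D (gT mk gx κ Φ t p D) (fT mk fx κ Φ t p D))) + vL κ Φ t p D (gT mk gx κ Φ t p D) (fT mk fx κ Φ t p D) * ρ)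
    (hΛ₀ : 4 * |Λ₀of κ Φ t p D (gT mk gx κ Φ t p D) (fT mk fx κ Φ t p D) yX| ≤ 7 * modulus (nL κ Φ t p D (gT mk gx κ Φ t p D) (fT mk fx κ Φ t p D)) (hL κ Φ t p D (gT mk gx κ Φ t p D) (fT mk fx κ Φ t p D)) (vL κ Φ t p D (gT mk gx κ Φ t p D) (fT mk fx κ Φ t p D)) (Skelφ.NegPrm.vβOf (nL κ Φ t p D (gT mk gx κ Φ t p D) (fT mk fx κ Φ t p D)) (hL κ Φ t p D (gT mk gx κ Φ t p D) (fT mk fx κ Φ t p D)) (ℓL κ Φ t p D (gT mk gx κ Φ t p D) (fT mk fx κ Φ t p D)) (vL κ Φ t p D (gT mk gx κ Φ t p D) (fT mk fx κ Φ t p D)))) :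
    ∀ k ≤ NyOfA κ Φ t p D (gT mk gx κ Φ t p D) (fT mk fx κ Φ t p D) σ' yY,
      -(5 * ((fcellsA κ Φ t p D (gT mk gx κ Φ t p D) (fT mk fx κ Φ t p D)).r 0 : ℤ) - 2) ≤ TwoAxis.Para.coarse (20 * ((fcellsA κ Φ t p D (gT mk gx κ Φ t p D) (fT mk fx κ Φ t p D)).K : ℤ) * (((fcellsA κ Φ t p D (gT mk gx κ Φ t p D) (fT mk fx κ Φ t p D)).s 0 : ℕ) : ℤ)) (Skelφ.NegPrm.DofA (Aof κ) (nL κ Φ t p D (gT mk gx κ Φ t p D) (fT mk fx κ Φ t p D)) (hL κ Φ t p D (gT mk gx κ Φ t p D) (fT mk fx κ Φ t p D)) (ℓL κ Φ t p D (gT mk gx κ Φ t p D) (fT mk fx κ Φ t p D)) (vL κ Φ t p D (gT mk gx κ Φ t p D) (fT mk fx κ Φ t p D)) / 2) (Skelφ.NegPrm.DofA (Aof κ) (nL κ Φ t p D (gT mk gx κ Φ t p D) (fT mk fx κ Φ t p D)) (hL κ Φ t p D (gT mk gx κ Φ t p D) (fT mk fx κ Φ t p D)) (ℓL κ Φ t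 p D (gT mk gx κ Φ t p D) (fT mk fx κ Φ t p D)) (vL κ Φ t p D (gT mk gx κ Φ t p D) (fT mk fx κ Φ t p D))) (TwoAxis.Para.lam0 (Aof κ) (vL κ Φ t p D (gT mk gx κ Φ t p D) (fT mk fx κ Φ t p D)) (Skelφ.NegPrm.vβOf (nL κ Φ t p D (gT mk gx κ Φ t p D) (fT mk fx κ Φ t p D)) (hL κ Φ t p D (gT mk gx κ Φ t p D) (fT mk fx κ Φ t p D)) (ℓL κ Φ t p D (gT mk gx κ Φ t p D) (fT mk fx κ Φ t p D)) (vL κ Φ t p D (gT mk gx κ Φ t p D) (fT mk fx κ Φ t p D))) yY) +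
        ((20 * ((fcellsA κ Φ t p D (gT mk gx κ Φ t p D) (fT mk fx κ Φ t p D)).K : ℤ) * (((fcellsA κ Φ t p D (gT mk gx κ Φ t p D) (fT mk fx κ Φ t p D)).s 0 : ℕ) : ℤ)) * (Aof κ * (modulus (nL κ Φ t p D (gT mk gx κ Φ t p D) (fT mk fx κ Φ t p D)) (hL κ Φ t p D (gT mk gx κ Φ t p D) (fT mk fx κ Φ t p D)) (vL κ Φ t p D (gT mk gx κ Φ t p D) (fT mk fx κ Φ t p D)) (Skelφ.NegPrm.vβOf (nL κ Φ t p D (gT mk gx κ Φ t p D) (fT mk fx κ Φ t p D)) (hL κ Φ t p D (gT mk gx κ Φ t p D) (fT mk fx κ Φ t p D)) (ℓL κ Φ t p D (gT mk gx κ Φ t p D) (fT mk fx κ Φ t p D)) (vL κ Φ t p D (gT mk gx κ Φ t p D) (fT mk fx κ Φ t p D))) * (min (σ' * (qaLo κ Φ t p D (gT mk gx κ Φ t p D) (fT mk fx κ Φ t p D) mk k)) (σ' * (qaHi κ Φ t p D (gT mk gx κ Φ t p D) (fT mk fx κ Φ t p D) mk k))) -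
          max ((vL κ Φ t p D (gT mk gx κ Φ t p D) (fT mk fx κ Φ t p D)) * ((shearUnit (nL κ Φ t p D (gT mk gx κ Φ t p D) (fT mk fx κ Φ t p D)) (hL κ Φ t p D (gT mk gx κ Φ t p D) (fT mk fx κ Φ t p D)) : ℤ) * (min (σ' * (qbLo κ Φ t p D (gT mk gx κ Φ t p D) (fT mk fx κ Φ t p D) mk (qY κ Φ t p D (gT mk gx κ Φ t p D) (fT mk fx κ Φ t p D) mk) k)) (σ' * (qbHi κ Φ t p D (gT mk gx κ Φ t p D) (fT mk fx κ Φ t p D) mk (qY κ Φ t p D (gT mk gx κ Φ t p D) (fT mk fx κ Φ t p D) mk) k)) - 1))) ((vL κ Φ t p D (gT mk gx κ Φ t p D) (fT mk fx κ Φ t p D)) * ((shearUnit (nL κ Φ t p D (gT mk gx κ Φ t p D) (fT mk fx κ Φ t p D)) (hL κ Φ t p D (gT mk gx κ Φ t p D) (fT mk fx κ Φ t p D)) : ℤ) * (max (σ' * (qbLo κ Φ t p D (gT mk gx κ Φ t p D) (fT mk fx κ Φ t p D) mk (qY κ Φ t p D (gT mk gx κ Φ t p D) (fT mk fx κ Φ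 t p D) mk) k)) (σ' * (qbHi κ Φ t p D (gT mk gx κ Φ t p D) (fT mk fx κ Φ t p D) mk (qY κ Φ t p D (gT mk gx κ Φ t p D) (fT mk fx κ Φ t p D) mk) k))) + (shearUnit (nL κ Φ t p D (gT mk gx κ Φ t p D) (fT mk fx κ Φ t p D)) (hL κ Φ t p D (gT mk gx κ Φ t p D) (fT mk fx κ Φ t p D)) : ℤ) - 1))) / (nL κ Φ t p D (gT mk gx κ Φ t p D) (fT mk fx κ Φ t p D) : ℤ))) / (Skelφ.NegPrm.DofA (Aof κ) (nL κ Φ t p D (gT mk gx κ Φ t p D) (fT mk fx κ Φ t p D)) (hL κ Φ t p D (gT mk gx κ Φ t p D) (fT mk fx κ Φ t p D)) (ℓL κ Φ t p D (gT mk gx κ Φ t p D) (fT mk fx κ Φ t p D)) (vL κ Φ t p D (gT mk gx κ Φ t p D) (fT mk fx κ Φ t p D))) ∧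
      TwoAxis.Para.coarse (20 * ((fcellsA κ Φ t p D (gT mk gx κ Φ t p D) (fT mk fx κ Φ t p D)).K : ℤ) * (((fcellsA κ Φ t p D (gT mk gx κ Φ t p D) (fT mk fx κ Φ t p D)).s 0 : ℕ) : ℤ)) (Skelφ.NegPrm.DofA (Aof κ) (nL κ Φ t p D (gT mk gx κ Φ t p D) (fT mk fx κ Φ t p D)) (hL κ Φ t p D (gT mk gx κ Φ t p D) (fT mk fx κ Φ t p D)) (ℓL κ Φ t p D (gT mk gx κ Φ t p D) (fT mk fx κ Φ t p D)) (vL κ Φ t p D (gT mk gx κ Φ t p D) (fT mk fx κ Φ t p D)) / 2) (Skelφ.NegPrm.DofA (Aof κ) (nL κ Φ t p D (gT mk gx κ Φ t p D) (fT mk fx κ Φ t p D)) (hL κ Φ t p D (gT mk gx κ Φ t p D) (fT mk fx κ Φ t p D)) (ℓL κ Φ t p D (gT mk gx κ Φ t p D) (fT mk fx κ Φ t p D)) (vL κ Φ t p D (gT mk gx κ Φ t p D) (fT mk fx κ Φ t p D))) (TwoAxis.Para.lam0 (Aof κ) (vL κ Φ t p D (gT mk gx κ Φ t p D) (fT mk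 fx κ Φ t p D)) (Skelφ.NegPrm.vβOf (nL κ Φ t p D (gT mk gx κ Φ t p D) (fT mk fx κ Φ t p D)) (hL κ Φ t p D (gT mk gx κ Φ t p D) (fT mk fx κ Φ t p D)) (ℓL κ Φ t p D (gT mk gx κ Φ t p D) (fT mk fx κ Φ t p D)) (vL κ Φ t p D (gT mk gx κ Φ t p D) (fT mk fx κ Φ t p D))) yY) +
        ((20 * ((fcellsA κ Φ t p D (gT mk gx κ Φ t p D) (fT mk fx κ Φ t p D)).K : ℤ) * (((fcellsA κ Φ t p D (gT mk gx κ Φ t p D) (fT mk fx κ Φ t p D)).s 0 : ℕ) : ℤ)) * (Aof κ * (modulus (nL κ Φ t p D (gT mk gx κ Φ t p D) (fT mk fx κ Φ t p D)) (hL κ Φ t p D (gT mk gx κ Φ t p D) (fT mk fx κ Φ t p D)) (vL κ Φ t p D (gT mk gx κ Φ t p D) (fT mk fx κ Φ t p D)) (Skelφ.NegPrm.vβOf (nL κ Φ t p D (gT mk gx κ Φ t p D) (fT mk fx κ Φ t p D)) (hL κ Φ t p D (gT mk gx κ Φ t p D) (fT mk fx κ Φ t p D)) (ℓL κ Φ t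 p D (gT mk gx κ Φ t p D) (fT mk fx κ Φ t p D)) (vL κ Φ t p D (gT mk gx κ Φ t p D) (fT mk fx κ Φ t p D))) * (max (σ' * (qaLo κ Φ t p D (gT mk gx κ Φ t p D) (fT mk fx κ Φ t p D) mk k)) (σ' * (qaHi κ Φ t p D (gT mk gx κ Φ t p D) (fT mk fx κ Φ t p D) mk k))) -
          min ((vL κ Φ t p D (gT mk gx κ Φ t p D) (fT mk fx κ Φ t p D)) * ((shearUnit (nL κ Φ t p D (gT mk gx κ Φ t p D) (fT mk fx κ Φ t p D)) (hL κ Φ t p D (gT mk gx κ Φ t p D) (fT mk fx κ Φ t p D)) : ℤ) * (min (σ' * (qbLo κ Φ t p D (gT mk gx κ Φ t p D) (fT mk fx κ Φ t p D) mk (qY κ Φ t p D (gT mk gx κ Φ t p D) (fT mk fx κ Φ t p D) mk) k)) (σ' * (qbHi κ Φ t p D (gT mk gx κ Φ t p D) (fT mk fx κ Φ t p D) mk (qY κ Φ t p D (gT mk gx κ Φ t p D) (fT mk fx κ Φ t p D) mk) k)) - 1))) ((vL κ Φ t p D (gT mk gx κ Φ t p D) (fT mk fx κ Φ t p D)) *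 ((shearUnit (nL κ Φ t p D (gT mk gx κ Φ t p D) (fT mk fx κ Φ t p D)) (hL κ Φ t p D (gT mk gx κ Φ t p D) (fT mk fx κ Φ t p D)) : ℤ) * (max (σ' * (qbLo κ Φ t p D (gT mk gx κ Φ t p D) (fT mk fx κ Φ t p D) mk (qY κ Φ t p D (gT mk gx κ Φ t p D) (fT mk fx κ Φ t p D) mk) k)) (σ' * (qbHi κ Φ t p D (gT mk gx κ Φ t p D) (fT mk fx κ Φ t p D) mk (qY κ Φ t p D (gT mk gx κ Φ t p D) (fT mk fx κ Φ t p D) mk) k))) + (shearUnit (nL κ Φ t p D (gT mk gx κ Φ t p D) (fT mk fx κ Φ t p D)) (hL κ Φ t p D (gT mk gx κ Φ t p D) (fT mk fx κ Φ t p D)) : ℤ) - 1))) / (nL κ Φ t p D (gT mk gx κ Φ t p D) (fT mk fx κ Φ t p D) : ℤ))) / (Skelφ.NegPrm.DofA (Aof κ) (nL κ Φ t p D (gT mk gx κ Φ t p D) (fT mk fx κ Φ t p D)) (hL κ Φ t p D (gT mk gx κ Φ t p D) (fT mk fx κ Φ t p D)) (ℓL κ Φ t p D (gT mk gx κ Φ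 t p D) (fT mk fx κ Φ t p D)) (vL κ Φ t p D (gT mk gx κ Φ t p D) (fT mk fx κ Φ t p D))) + 1 ≤
        5 * ((fcellsA κ Φ t p D (gT mk gx κ Φ t p D) (fT mk fx κ Φ t p D)).r 0 : ℤ) - 2 := by
  obtain ⟨hn1, hℓ1⟩ := one_le_of_eqNumL κ Φ t p D _ _ hN
  have hm0 := (Skelφ.NegPrm.modulus_vβOf hn1 (hL κ Φ t p D (gT mk gx κ Φ t p D) (fT mk fx κ Φ t p D)) (ℓL κ Φ t p D (gT mk gx κ Φ t p D) (fT mk fx κ Φ t p D)) (vL κ Φ t p D (gT mk gx κ Φ t p D) (fT mk fx κ Φ t p D))).1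
  have hmℓ := (Skelφ.NegPrm.modulus_vβOf hn1 (hL κ Φ t p D (gT mk gx κ Φ t p D) (fT mk fx κ Φ t p D)) (ℓL κ Φ t p D (gT mk gx κ Φ t p D) (fT mk fx κ Φ t p D)) (vL κ Φ t p D (gT mk gx κ Φ t p D) (fT mk fx κ Φ t p D))).2
  have hm : (nL κ Φ t p D (gT mk gx κ Φ t p D) (fT mk fx κ Φ t p D) : ℤ) * ((ℓL κ Φ t p D (gT mk gx κ Φ t p D) (fT mk fx κ Φ t p D) : ℤ) - 1) < modulus (nL κ Φ t p D (gT mk gx κ Φ t p D) (fT mk fx κ Φ t p D)) (hL κ Φ t p D (gT mk gx κ Φ t p D) (fT mk fx κ Φ t p D)) (vL κ Φ t p D (gT mk gx κ Φ t p D) (fT mk fx κ Φ t p D)) (Skelφ.NegPrm.vβOf (nL κ Φ t p D (gT mk gx κ Φ t p D) (fT mk fx κ Φ t p D)) (hL κ Φ t p D (gT mk gx κ Φ t p D) (fT mk fx κ Φ t p D)) (ℓL κ Φ t p D (gT mk gx κ Φ t p D) (fT mk fx κ Φ t p D)) (vL κ Φ t p D (gT mk gx κ Φ t p D) (fT mk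 fx κ Φ t p D))) := by linarith
  obtain ⟨hc0, hc1, hr0, hr1, hb0, hb1, hu0', hu1⟩ := units_eqA κ Φ t p D (gT mk gx κ Φ t p D) (fT mk fx κ Φ t p D)
  have hA2 : (2 : ℤ) ≤ Aof κ := by have := le_Aof κ; linarith
  have hAe : (2 : ℤ) ∣ Aof κ := ⟨10 * (Neg.K κ : ℤ), by rw [Aof_eq_K]; ring⟩
  have hKq : (1 : ℤ) ≤ (Neg.Kq κ : ℤ) := by exact_mod_cast Neg.one_le_Kq κ
  have hKq0 : (0 : ℤ) ≤ 1000 * (Neg.Kq κ : ℤ) := by linarith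
  have hKq1 : (0 : ℤ) ≤ 1000 * (Neg.Kq κ : ℤ) - 1 := by linarith
  have hv : |(vL κ Φ t p D (gT mk gx κ Φ t p D) (fT mk fx κ Φ t p D))| ≤ (nL κ Φ t p D (gT mk gx κ Φ t p D) (fT mk fx κ Φ t p D) : ℤ) := hN.v_le
  have hn : (1 : ℤ) ≤ (nL κ Φ t p D (gT mk gx κ Φ t p D) (fT mk fx κ Φ t p D) : ℤ) := by exact_mod_cast hn1
  have h10 : ((((hL κ Φ t p D (gT mk gx κ Φ t p D) (fT mk fx κ Φ t p D))).natAbs : ℤ)) ≤ 10 * (nL κ Φ t p D (gT mk gx κ Φ t p D) (fT mk fx κ Φ t p D) : ℤ) := by exact_mod_cast hκ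
  have h0' : (0 : ℤ) ≤ ((((hL κ Φ t p D (gT mk gx κ Φ t p D) (fT mk fx κ Φ t p D))).natAbs : ℤ)) := Nat.cast_nonneg _
  have hU : (nL κ Φ t p D (gT mk gx κ Φ t p D) (fT mk fx κ Φ t p D) : ℤ) ≤ (shearUnit (nL κ Φ t p D (gT mk gx κ Φ t p D) (fT mk fx κ Φ t p D)) (hL κ Φ t p D (gT mk gx κ Φ t p D) (fT mk fx κ Φ t p D)) : ℤ) ∧ (shearUnit (nL κ Φ t p D (gT mk gx κ Φ t p D) (fT mk fx κ Φ t p D)) (hL κ Φ t p D (gT mk gx κ Φ t p D) (fT mk fx κ Φ t p D)) : ℤ) ≤ 11 * (nL κ Φ t p D (gT mk gx κ Φ t p D) (fT mk fx κ Φ t p D) : ℤ) := by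
    unfold Skelφ.shearUnit; simp only [Nat.cast_add]; constructor <;> linarith
  have hRA : (0 : ℤ) ≤ (RA' κ Φ t p D mk : ℤ) := Nat.cast_nonneg _
  have hRAn : 2000 * (Neg.Kq κ : ℤ) * ((RA' κ Φ t p D mk : ℤ) + 2) ≤ (nL κ Φ t p D (gT mk gx κ Φ t p D) (fT mk fx κ Φ t p D) : ℤ) := by exact_mod_cast hnA
  have hRAℓ : 22000 * (Neg.Kq κ : ℤ) * ((RA' κ Φ t p D mk : ℤ) + 2) ≤ (ℓL κ Φ t p D (gT mk gx κ Φ t p D) (fT mk fx κ Φ t p D) : ℤ) := by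
    have h1 : ((22000 * Neg.Kq κ * (RA' κ Φ t p D mk + 2) : ℕ) : ℤ) ≤ (ML κ Φ t p D (gT mk gx κ Φ t p D) : ℤ) := by exact_mod_cast hMA
    have h2 := hN.ℓ_le
    push_cast at h1; linarith
  clear hnA hMA
  have hℓ44 : (44000 : ℤ) ≤ (ℓL κ Φ t p D (gT mk gx κ Φ t p D) (fT mk fx κ Φ t p D) : ℤ) := by
    have hQRA : (0 : ℤ) ≤ (Neg.Kq κ : ℤ) * (RA' κ Φ t p D mk : ℤ) := mul_nonneg (Nat.cast_nonneg _) (Nat.cast_nonneg _)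
    linarith
  obtain ⟨sL, sH, sH', sLa⟩ := sY_spec κ Φ t p D (gT mk gx κ Φ t p D) (fT mk fx κ Φ t p D) hn1
  have hUpos : (0:ℤ) < (shearUnit (nL κ Φ t p D (gT mk gx κ Φ t p D) (fT mk fx κ Φ t p D)) (hL κ Φ t p D (gT mk gx κ Φ t p D) (fT mk fx κ Φ t p D)) : ℤ) := by linarith
  have sL' : (shearUnit (nL κ Φ t p D (gT mk gx κ Φ t p D) (fT mk fx κ Φ t p D)) (hL κ Φ t p D (gT mk gx κ Φ t p D) (fT mk fx κ Φ t p D)) : ℤ) * sLoY κ Φ t p D (gT mk gx κ Φ t p D) (fT mk fx κ Φ t p D) ≤ (nL κ Φ t p D (gT mk gx κ Φ t p D) (fT mk fx κ Φ t p D) : ℤ) * (ℓL κ Φ t p D (gT mk gx κ Φ t p D) (fT mk fx κ Φ t p D) : ℤ) - (shearUnit (nL κ Φ t p D (gT mk gx κ Φ t p D) (fT mk fx κ Φ t p D)) (hL κ Φ t p D (gT mk gx κ Φ t p D) (fT mk fx κ Φ t p D)) : ℤ) + 1 := by unfold sLoY; exact Int.mul_ediv_self_le hUpos.ne'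
  have hUqY : (shearUnit (nL κ Φ t p D (gT mk gx κ Φ t p D) (fT mk fx κ Φ t p D)) (hL κ Φ t p D (gT mk gx κ Φ t p D) (fT mk fx κ Φ t p D)) : ℤ) * ((qY κ Φ t p D (gT mk gx κ Φ t p D) (fT mk fx κ Φ t p D) mk) : ℤ) ≤ (nL κ Φ t p D (gT mk gx κ Φ t p D) (fT mk fx κ Φ t p D) : ℤ) * (ℓL κ Φ t p D (gT mk gx κ Φ t p D) (fT mk fx κ Φ t p D) : ℤ) + (shearUnit (nL κ Φ t p D (gT mk gx κ Φ t p D) (fT mk fx κ Φ t p D)) (hL κ Φ t p D (gT mk gx κ Φ t p D) (fT mk fx κ Φ t p D)) : ℤ) * (4 * (RA' κ Φ t p D mk : ℤ) + 4) := by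
    unfold qY; push_cast
    have hW := (Wrun_spec κ Φ t p D (gT mk gx κ Φ t p D) (fT mk fx κ Φ t p D) hn1).1
    nlinarith [hU.1]
  obtain ⟨hN', hcen⟩ := NyOfA_spec κ Φ t p D (gT mk gx κ Φ t p D) (fT mk fx κ Φ t p D) hN hσ' yY hΛ₁3
  have hN1 : ((NyOfA κ Φ t p D (gT mk gx κ Φ t p D) (fT mk fx κ Φ t p D) σ' yY) : ℤ) + 1 ≤ 1000 * (Neg.Kq κ : ℤ) := by
    have h' : ((0 + 1 + 3 + 1 + NyOfA κ Φ t p D (gT mk gx κ Φ t p D) (fT mk fx κ Φ t p D) σ' yY : ℕ) : ℤ) ≤ ((1000 * Neg.Kq κ : ℕ) : ℤ) := by exact_mod_cast hN'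
    push_cast at h'; linarith
  clear hN'
  have hq0 : (0:ℤ) ≤ ((qY κ Φ t p D (gT mk gx κ Φ t p D) (fT mk fx κ Φ t p D) mk) : ℤ) := Nat.cast_nonneg _
  have hLa0 : (0:ℤ) ≤ (LaY κ Φ t p D (gT mk gx κ Φ t p D) (fT mk fx κ Φ t p D) : ℤ) := Nat.cast_nonneg _
  intro k hk
  have hk0 : (0:ℤ) ≤ (k:ℤ) := Nat.cast_nonneg _
  have hkN : (k:ℤ) ≤ ((NyOfA κ Φ t p D (gT mk gx κ Φ t p D) (fT mk fx κ Φ t p D) σ' yY) : ℤ) := by exact_mod_cast hk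
  clear hk
  clear hcen
  obtain ⟨hv1, hv2⟩ := abs_le.1 hv
  have ha1 : (((((nL κ Φ t p D (gT mk gx κ Φ t p D) (fT mk fx κ Φ t p D) : ℤ)) + (vL κ Φ t p D (gT mk gx κ Φ t p D) (fT mk fx κ Φ t p D))).toNat : ℤ)) = (nL κ Φ t p D (gT mk gx κ Φ t p D) (fT mk fx κ Φ t p D) : ℤ) + (vL κ Φ t p D (gT mk gx κ Φ t p D) (fT mk fx κ Φ t p D)) := Int.toNat_of_nonneg (by linarith)
  have ha2 : (((((nL κ Φ t p D (gT mk gx κ Φ t p D) (fT mk fx κ Φ t p D) : ℤ)) - (vL κ Φ t p D (gT mk gx κ Φ t p D) (fT mk fx κ Φ t p D))).toNat : ℤ)) = (nL κ Φ t p D (gT mk gx κ Φ t p D) (fT mk fx κ Φ t p D) : ℤ) - (vL κ Φ t p D (gT mk gx κ Φ t p D) (fT mk fx κ Φ t p D)) := Int.toNat_of_nonneg (by linarith)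
  have hu17 : 17 ≤ u₀A κ Φ t p D (gT mk gx κ Φ t p D) (fT mk fx κ Φ t p D) := by
    obtain ⟨hs0, -⟩ := cells_geTA' κ Φ t p D mk gx (fT mk fx κ Φ t p D) hN hκ
    have hq : (1 : ℤ) ≤ Neg.Kq κ := by exact_mod_cast Neg.one_le_Kq κ
    have hR1 : (1 : ℤ) ≤ (RA' κ Φ t p D mk : ℤ) := by have := (RA'_eq κ Φ t p D mk).1; exact_mod_cast (by omega : 1 ≤ RA' κ Φ t p D mk)
    have h17 := mul_le_mul hq (show (17:ℤ) ≤ ((((fcellsA κ Φ t p D (gT mk gx κ Φ t p D) (fT mk fx κ Φ t p D)).s 0 : ℕ) : ℤ)) by linarith) (by norm_num) (by linarith)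
    unfold u₀A; linarith
  unfold TwoAxis.Para.coarse
  rw [hc0, DofA_eq', (lam_eqA κ Φ t p D (gT mk gx κ Φ t p D) (fT mk fx κ Φ t p D) yY).1]
  have e1 : -(5 * ((fcellsA κ Φ t p D (gT mk gx κ Φ t p D) (fT mk fx κ Φ t p D)).r 0 : ℤ) - 2) = -(5 * (40 * (Neg.Kq κ : ℤ) * u₀A κ Φ t p D (gT mk gx κ Φ t p D) (fT mk fx κ Φ t p D)) - 2) := by rw [hr0]
  have e2 : 5 * ((fcellsA κ Φ t p D (gT mk gx κ Φ t p D) (fT mk fx κ Φ t p D)).r 0 : ℤ) - 2 = 5 * (40 * (Neg.Kq κ : ℤ) * u₀A κ Φ t p D (gT mk gx κ Φ t p D) (fT mk fx κ Φ t p D)) - 2 := by rw [hr0]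
  rw [e1, e2]
  unfold qaLo qaHi qbLo qbHi
  rw [ha1, ha2]
  generalize u₀A κ Φ t p D (gT mk gx κ Φ t p D) (fT mk fx κ Φ t p D) = u at hu17 ⊢
  generalize Λ₀of κ Φ t p D (gT mk gx κ Φ t p D) (fT mk fx κ Φ t p D) yY = Λ at hrel ⊢
  generalize Λ₀of κ Φ t p D (gT mk gx κ Φ t p D) (fT mk fx κ Φ t p D) yX = Λx at hrel hΛ₀ ⊢
  generalize ((NyOfA κ Φ t p D (gT mk gx κ Φ t p D) (fT mk fx κ Φ t p D) σ' yY) : ℤ) = N at hN1 hkN ⊢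
  generalize (k : ℤ) = K at hk0 hkN ⊢
  generalize modulus (nL κ Φ t p D (gT mk gx κ Φ t p D) (fT mk fx κ Φ t p D)) (hL κ Φ t p D (gT mk gx κ Φ t p D) (fT mk fx κ Φ t p D)) (vL κ Φ t p D (gT mk gx κ Φ t p D) (fT mk fx κ Φ t p D)) (Skelφ.NegPrm.vβOf (nL κ Φ t p D (gT mk gx κ Φ t p D) (fT mk fx κ Φ t p D)) (hL κ Φ t p D (gT mk gx κ Φ t p D) (fT mk fx κ Φ t p D)) (ℓL κ Φ t p D (gT mk gx κ Φ t p D) (fT mk fx κ Φ t p D)) (vL κ Φ t p D (gT mk gx κ Φ t p D) (fT mk fx κ Φ t p D))) = M at hm hmℓ hrel hΛ₀ ⊢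
  generalize ((qY κ Φ t p D (gT mk gx κ Φ t p D) (fT mk fx κ Φ t p D) mk) : ℤ) = Q at hUqY hq0 ⊢
  generalize sLoY κ Φ t p D (gT mk gx κ Φ t p D) (fT mk fx κ Φ t p D) = sl at sL sL' ⊢
  generalize sHiY κ Φ t p D (gT mk gx κ Φ t p D) (fT mk fx κ Φ t p D) = sh at sH sH' ⊢
  generalize (LaY κ Φ t p D (gT mk gx κ Φ t p D) (fT mk fx κ Φ t p D) : ℤ) = La at sLa hLa0 ⊢
  generalize (shearUnit (nL κ Φ t p D (gT mk gx κ Φ t p D) (fT mk fx κ Φ t p D)) (hL κ Φ t p D (gT mk gx κ Φ t p D) (fT mk fx κ Φ t p D)) : ℤ) = Uz at hU hUpos sL sL' sH sH' sLa hUqY ⊢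
  generalize (vL κ Φ t p D (gT mk gx κ Φ t p D) (fT mk fx κ Φ t p D)) = v at hv hv1 hv2 hrel ⊢
  generalize (RA' κ Φ t p D mk : ℤ) = R at hRA hRAn hRAℓ hUqY ⊢
  generalize (nL κ Φ t p D (gT mk gx κ Φ t p D) (fT mk fx κ Φ t p D) : ℤ) = n at hn hm hmℓ hU hRAn sL sL' sH sH' sLa hUqY hv hv1 hv2 hrel hρ1' ⊢
  generalize (ℓL κ Φ t p D (gT mk gx κ Φ t p D) (fT mk fx κ Φ t p D) : ℤ) = ℓ at hm hmℓ hRAℓ hℓ44 sL sL' sH sH' sLa hUqY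
  clear e1 e2 ha1 ha2 hc0 hc1 hr0 hr1 hb0 hb1 hu0' hu1 hm0 h10 h0' hκ hN hΛ₁3
  generalize (Neg.Kq κ : ℤ) = Qq at hKq hKq0 hKq1 hN1 hRAn hRAℓ ⊢
  -- the level window of region `K`
  have hK1 : K + 1 ≤ 1000 * Qq := by linarith
  have e1 := mul_le_mul_of_nonneg_left sL hk0
  have e2 := mul_le_mul_of_nonneg_left hmℓ hk0
  have e3 := mul_le_mul_of_nonneg_left sH hk0
  have e4 := mul_le_mul_of_nonneg_left (show n * ℓ ≤ M + n by linarith) hk0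
  have hKn : (0:ℤ) ≤ K * n := mul_nonneg hk0 (by linarith)
  have hKU : (0:ℤ) ≤ K * Uz := mul_nonneg hk0 hUpos.le
  have hKR : (0:ℤ) ≤ (K + 1) * (Uz * R) := mul_nonneg (by linarith) (mul_nonneg hUpos.le hRA)
  have hbL : K * M - (K * (n + 2 * Uz) + Uz * Q + (K + 1) * (Uz * R) + 3 * (n * ℓ) + 3 * Uz) ≤ Uz * (K * sl - Q - K * R - R - La) - Uz := by
    have : Uz * (K * sl - Q - K * R - R - La) = K * (Uz * sl) - Uz * Q - (K + 1) * (Uz * R) - Uz * La := by ring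
    rw [this]; linarith
  have hbH : Uz * (K * sh + Q + K * R + R + La) + Uz - 1 ≤ K * M + (K * (n + 2 * Uz) + Uz * Q + (K + 1) * (Uz * R) + 3 * (n * ℓ) + 3 * Uz) := by
    have : Uz * (K * sh + Q + K * R + R + La) = K * (Uz * sh) + Uz * Q + (K + 1) * (Uz * R) + Uz * La := by ring
    rw [this]; linarith
  have hss : sl < sh := by
    by_contra hc; push Not at hc
    have := mul_le_mul_of_nonneg_left hc hUpos.le
    linarith
  have hbLH : K * sl - Q - K * R - R - La ≤ K * sh + Q + K * R + R + La := by
    have := mul_le_mul_of_nonneg_left hss.le hk0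
    have : (0:ℤ) ≤ K * R := mul_nonneg hk0 hRA
    linarith
  obtain ⟨l1, l2⟩ := RootArith.levels_abs (m := M) (K := K) (rβ := K * (n + 2 * Uz) + Uz * Q + (K + 1) * (Uz * R) + 3 * (n * ℓ) + 3 * Uz) (by linarith) hσ' hbL hbLH hbH
  have hX1 : |Uz * (min (σ' * (K * sl - Q - K * R - R - La)) (σ' * (K * sh + Q + K * R + R + La)) - 1) - σ' * (K * M)| ≤
      K * (n + 2 * Uz) + Uz * Q + (K + 1) * (Uz * R) + 3 * (n * ℓ) + 3 * Uz + Uz := by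
    have : Uz * (min (σ' * (K * sl - Q - K * R - R - La)) (σ' * (K * sh + Q + K * R + R + La)) - 1) =
        Uz * (min (σ' * (K * sl - Q - K * R - R - La)) (σ' * (K * sh + Q + K * R + R + La))) - Uz := by ring
    rw [this]; exact l1
  have hr7 : K * (n + 2 * Uz) + Uz * Q + (K + 1) * (Uz * R) + 3 * (n * ℓ) + 3 * Uz + Uz + 1 ≤ 7 * M := by
    have t1 : K * (n + 2 * Uz) ≤ (1000 * Qq - 1) * (23 * n) := mul_le_mul (by linarith) (by linarith [hU.2]) (by linarith [hU.1]) hKq1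
    have t2 : (K + 1) * (Uz * R) ≤ 1000 * Qq * (11 * n * R) := mul_le_mul hK1 (mul_le_mul_of_nonneg_right hU.2 hRA) (mul_nonneg hUpos.le hRA) hKq0
    have t3 : Uz * (4 * R + 4) ≤ 11 * n * (4 * R + 4) := mul_le_mul_of_nonneg_right hU.2 (by linarith)
    have t4 : n * (22000 * Qq * (R + 2)) ≤ n * ℓ := mul_le_mul_of_nonneg_left hRAℓ (le_trans zero_le_one hn)
    have t5 : (0:ℤ) ≤ n * R := mul_nonneg (by linarith) hRA
    have t6 := le_mul_of_one_le_left t5 hKq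
    have t7 := le_mul_of_one_le_left (le_trans zero_le_one hn) hKq
    linarith [hU.2]
  have hX2 := l2
  -- the transverse window of region `K`
  have haL : K * v - v - (2 * n + (K + 1) * R) ≤ K * v - (n + v + K * R) - R - n := by linarith
  have haH : K * v + (n - v + K * R) + R + n ≤ K * v - v + (2 * n + (K + 1) * R) := by linarith
  have haLH : K * v - (n + v + K * R) - R - n ≤ K * v + (n - v + K * R) + R + n := by
    have : (0:ℤ) ≤ K * R := mul_nonneg hk0 hRA
    linarith
  have hra' : 2 * n + (K + 1) * R ≤ 3 * n := by
    have : (K + 1) * R ≤ 1000 * Qq * R := mul_le_mul_of_nonneg_right hK1 hRA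
    linarith
  have hr0' : (0:ℤ) ≤ K * (n + 2 * Uz) + Uz * Q + (K + 1) * (Uz * R) + 3 * (n * ℓ) + 3 * Uz + Uz := by
    have a1 : (0:ℤ) ≤ K * (n + 2 * Uz) := mul_nonneg hk0 (by linarith)
    have a2 : (0:ℤ) ≤ Uz * Q := mul_nonneg hUpos.le hq0
    have a3 : (0:ℤ) ≤ n * ℓ := mul_nonneg (by linarith) (by linarith)
    linarith
  have hr7' : K * (n + 2 * Uz) + Uz * Q + (K + 1) * (Uz * R) + 3 * (n * ℓ) + 3 * Uz + Uz ≤ 7 * M := by linarith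
  exact RootArithA.regionY_transA (A := Aof κ) (Q := Qq) (u := u) (Λ := Λ) (Λx := Λx) (ρ := ρ) hA2 hAe hKq hu17 hn hm hv hℓ44 hσ' hσu haL haLH haH hra' hX1 hX2 hr0' hr7' hrel hρ0 hρ1' hΛ₀

end AtT

end KS

end NegB

end PlanarSkeletonNeg

end Summit.CriticalPhenomena.PercolationContinuityZ3.Theorems.Transplant
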